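import Summits.NavierStokesRegularity.FluidComputer.RGFixedPoint

/-!
# DesignSpectralRadius — the FEKETE CEILING of finite-depth cascade designs, and the Reynolds trapdoor
# (FLUID COMPUTER cell, idea-1 gen 19; zero compute)

HONEST FRAMING: low prior, high value-of-information experiment on Tao's machine paradigm;
NOT a claim that NS blows up.

Dictionary (cell files `pub-fluidc-idea-1/DESIGN-RADIUS.md`, `atlas/IDEA-1.md` §23, `PREREG-R2.md` §10s/§10bf).
`RGFixedPoint.LevelMap` is the cell's renormalised level map `M` (evolve for the level time, project on the
out-band, dilate back, [renormalise]) with the one-level sup-velocity gain `gain` and scale ratio `λ > 1`;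
a MACHINE seed is a state `v` whose ladder `r_n = gain(Mⁿ v)/λ` stays on the floor `r_n ≥ 1`.
The cell measures cascades one DESIGN at a time: the optimiser returns the best one-level gain
(`g⋆ = 3.2067`, R3 pass 0, three engines), the best two-level relay (`Q₂⋆ = g₁g₂ = 1.945` @ 192³,
`2.12` @ 96³ design grid, row (d), `RelayBudget.lean`), and power iteration of `M` returns the attractor's
gain (`ḡ_∞ = 0.58 ± 0.03`, A-G10-1, `RGFixedPoint.lean`).  This file types the ONE structure these numbers
bracket, over an abstract level map; nothing about Navier–Stokes is asserted:

* `cumLog Φ v k = Σ_{i<k} log gain(Mⁱ v)` (log of `U_k/U_0` along the ladder) is a COCYCLE (`cumLog_add`), so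
  the k-level DESIGN OPTIMUM `design Φ k = sup_v cumLog Φ v k` (`= log Q_k⋆`) is SUBADDITIVE
  (`design_subadditive`) under a log-gain ceiling; by Fekete (Mathlib `Subadditive.tendsto_lim`)
  `design k / k → designRate Φ = inf_{k≥1} design k / k` (`tendsto_designRate`): the log of the DESIGN
  SPECTRAL RADIUS `ρ⋆` of the level map — the largest asymptotic per-level gain ANY seed can sustain.
* ONE-WINDOW KILL (`exists_subfloor_in_window`, `frequently_subfloor`, `no_machine_of_design_lt`): if ONE
  finite depth has `design k < k·log λ` (i.e. `Q_k⋆ < λᵏ`), every seed's ladder is below the floor somewhere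
  in EVERY window of `k` consecutive levels — no machine, no eventual machine, for any seed of the manifold.
* MACHINE ⇒ `log λ ≤ design k / k` for all `k ≥ 1` and `log λ ≤ designRate` (`log_lam_le_designRate_of_machine`).
* COMPLETENESS (`exists_depth_of_designRate_lt`, `designRate_lt_iff`): `ρ⋆ < λ` iff SOME finite depth
  already shows it.  Finite-depth design experiments are a complete test of "no seed of this manifold is a
  machine"; the depth needed is the first `k` with `Q_k⋆ < λᵏ`.  In the cell: depth 1 does not kill
  (`g⋆ = 3.2067 > 2`, `depth_one_no_kill`), depth 2 does on the measured slice (`Q₂⋆ ≤ 2.12 < 4 = λ²`,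
  `depth_two_kill`; bracket `log 0.58 ≤ log ρ⋆ ≤ ½ log 2.12 = log 1.456 < log 2`, `bracket_pins`).
* LOWER BRACKET (`log_le_designRate_of_tendsto`): if the gains along SOME power iteration converge to
  `g > 0` then `log g ≤ designRate` (Cesàro, Mathlib `Filter.Tendsto.cesaro`) — the attractor's `ḡ_∞` is a
  lower bracket of `ρ⋆`.
* REYNOLDS AXIS — the exit Reynolds numbers `Re(Mⁿ v) = Re(v)·Π r_i`, the gain ENVELOPE and the TRAPDOOR
  (`ReynoldsLaw.re_iterate`, `re_mono_of_machine`, `envelope_of_machine`, `trapdoor`, `trapdoor_decay`,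
  `trapdoor_tendsto_zero`) live in the sibling file `ReynoldsTrapdoor.lean` (same namespace; split from this
  file for the tree's 400-line limit), with the cell reading of the level-two exit Reynolds numbers there.

Caveats typed as hypotheses, not hidden: `LogCeiling` (a uniform log-gain bound `B`; for Leray solutions of
the band-limited problem `B = ½ log #out-band modes` from the energy inequality and Bernstein, or `B = log g⋆`
where the certified optimum is global); `BddBelow` of `design k / k` only where a limit is claimed
(`bddBelow_design_div` gives it from one seed with log-gains bounded below); an optimiser's value is a LOWER
estimate of `design k` (local optimum) — "`design 2 ≤ log 2.12`" is a measured, refutable claim of globality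
exactly like `RGFixedPoint.LevelMap.gain_iterate_le_of_opt`.  The energy-reset map `M_E` (power iteration,
`ḡ_∞`) and the physical map `M_NS` (relay rows, Reynolds law) agree on discretely self-similar orbits and only
there; brackets from the two maps are quoted separately.

Nearest prior art (prose; searched 2026-08-24, corpus fts+vec and galaxy): Fekete's lemma (Mathlib
`Subadditive`); the joint spectral radius of a matrix family as a subadditive sup-growth rate (Rota–Strang 1960,
Daubechies–Lagarias 1992; Morris arXiv:1905.00749 [galaxy:pdf:-1020997091261934260]); ergodic optimisation
`β(φ|T) = sup_μ ∫φ dμ = lim (1/n) sup_x φ_n(x)` with maximizing measures generically PERIODIC (Bousch, Contreras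
2016, Jenkinson's surveys; Bochi 2025 [galaxy:pdf:5004262220] p.2–3) — read here as "the best machine candidate
of a level map is a short cycle of `M`, i.e. a `λᵖ`-DSS profile"; transient vs asymptotic amplification of
non-normal operators (Farrell–Ioannou 1996; Trefethen–Embree 2005) — `g⋆ > λ > ρ⋆` is exactly "large transient,
sub-critical radius".  None of these is typed over a cascade level map in the tree (grep: no `Subadditive`/Fekete
in `Summits/NavierStokesRegularity/FluidComputer/`; `ReynoldsLadder.lean` is the ν-ladder scaling of observables,
`LevelReynoldsFloor.lean` the Cheskidov–Shvydkoy floor).  0 sorry; elementary.  Staged by planner seat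
pub-fluidc-idea-1 gen 19 (HOME/pub-fluidc-idea-1/lean/DesignSpectralRadius.lean); intended home
`Summits/NavierStokesRegularity/FluidComputer/DesignSpectralRadius.lean` (filing is the literature seat's call).

Provenance of this tree copy: filed by the cell's literature seat `pub-fluidc-lit` gen 44
(literature-prover-pub-fluidc-lit-g44-0, 2026-08-24) on idea-1 gen 19's LEAN ASK #12 (HOME/STATUS.md l.4665;
HOME/pub-fluidc-idea-1/lean/README.md gen-19 block); staged copy v2 sha16 `527ee7f72c67a267` (452 lines) —
statements and proofs byte-identical; the filing seat added only this provenance paragraph and SPLIT the staged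
file at its `## The Reynolds axis` section into this file + `ReynoldsTrapdoor.lean` (gate lint: ≤ 400 lines per
file), replacing the Reynolds bullet of this docstring by a pointer.  No named fact
is introduced: `LogCeiling` and `ReynoldsLaw` are hypothesis predicates consumed as explicit arguments
`(hB : LogCeiling Φ B)` / `(law : ReynoldsLaw Φ Re)` by the theorems below, never asserted.
-/

noncomputable section

open Filter Topology Function Finset

namespace Summit.NavierStokesRegularity.FluidComputer.DesignSpectralRadius

open RGFixedPoint

variable {X : Type*} (Φ : LevelMap X)

/-! ## Level gains along shifted seeds -/

/-- The ladder read from the shifted seed `Mⁿ v` is the tail of the ladder read from `v`. -/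
theorem levelGain_shift (v : X) (n i : ℕ) :
    Φ.levelGain (Φ.M^[n] v) i = Φ.levelGain v (n + i) := by
  show Φ.gain (Φ.M^[i] (Φ.M^[n] v)) = Φ.gain (Φ.M^[n + i] v)
  rw [← iterate_add_apply, Nat.add_comm]

/-- Floor at a level, unfolded: `1 ≤ r_n ↔ λ ≤ g_n`. -/
theorem one_le_levelRatio_iff {v : X} {n : ℕ} :
    1 ≤ Φ.levelRatio v n ↔ Φ.lam ≤ Φ.levelGain v n := by
  show 1 ≤ Φ.levelGain v n / Φ.lam ↔ _
  rw [le_div_iff₀ Φ.lam_pos, one_mul]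

/-- Sub-floor at a level, unfolded: `r_n < 1 ↔ g_n < λ`. -/
theorem levelRatio_lt_one_iff {v : X} {n : ℕ} :
    Φ.levelRatio v n < 1 ↔ Φ.levelGain v n < Φ.lam := by
  show Φ.levelGain v n / Φ.lam < 1 ↔ _
  rw [div_lt_iff₀ Φ.lam_pos, one_mul]

/-! ## The cumulative log-gain cocycle and the design sequence -/

/-- Cumulative log-gain of the first `k` levels of the ladder generated by `v`: `log (U_k / U_0)`. -/
def cumLog (v : X) (k : ℕ) : ℝ := ∑ i ∈ range k, Real.log (Φ.levelGain v i)

/-- Zero levels carry zero cumulative log-gain. -/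
@[simp] theorem cumLog_zero (v : X) : cumLog Φ v 0 = 0 := by simp [cumLog]

/-- **Cocycle**: `j + k` levels from `v` = `j` levels from `v` then `k` levels from `Mʲ v`. -/
theorem cumLog_add (v : X) (j k : ℕ) :
    cumLog Φ v (j + k) = cumLog Φ v j + cumLog Φ (Φ.M^[j] v) k := by
  unfold cumLog
  rw [sum_range_add]
  congr 1
  refine sum_congr rfl fun i _ => ?_
  rw [levelGain_shift]

/-- A uniform LOG-GAIN CEILING: every state's one-level gain has `log gain ≤ B`.  A modelling hypothesis,
consumed as `(hB : LogCeiling Φ B)`; nothing in this file asserts it of any level map. [folklore] -/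
def LogCeiling (B : ℝ) : Prop := ∀ w, Real.log (Φ.gain w) ≤ B

/-- The certified one-level optimum gives a log-gain ceiling where it is global and gains are positive. -/
theorem logCeiling_of_opt {gstar : ℝ} (hpos : ∀ w, 0 < Φ.gain w) (hopt : ∀ w, Φ.gain w ≤ gstar) :
    LogCeiling Φ (Real.log gstar) :=
  fun w => Real.log_le_log (hpos w) (hopt w)

variable {Φ}

/-- Under a log-gain ceiling `B`, `k` levels carry at most `k·B`. -/
theorem cumLog_le {B : ℝ} (hB : LogCeiling Φ B) (v : X) (k : ℕ) : cumLog Φ v k ≤ k * B := by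
  unfold cumLog
  calc ∑ i ∈ range k, Real.log (Φ.levelGain v i) ≤ ∑ _i ∈ range k, B :=
        sum_le_sum fun i _ => hB _
    _ = k * B := by simp

/-- A window of `k` consecutive floor levels starting at level `n` carries `k·log λ` of cumulative log-gain. -/
theorem window_le_cumLog {v : X} {n k : ℕ} (hfloor : ∀ i < k, 1 ≤ Φ.levelRatio v (n + i)) :
    k * Real.log Φ.lam ≤ cumLog Φ (Φ.M^[n] v) k := by
  unfold cumLog
  calc (k : ℝ) * Real.log Φ.lam = ∑ _i ∈ range k, Real.log Φ.lam := by simp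
    _ ≤ ∑ i ∈ range k, Real.log (Φ.levelGain (Φ.M^[n] v) i) := by
        refine sum_le_sum fun i hi => ?_
        rw [levelGain_shift]
        exact Real.log_le_log Φ.lam_pos ((one_le_levelRatio_iff Φ).mp (hfloor i (mem_range.mp hi)))

/-- Lower bound of a seed's cumulative log-gain from a lower bound on its log-gains. -/
theorem mul_le_cumLog {v : X} {b : ℝ} (hb : ∀ n, b ≤ Real.log (Φ.levelGain v n)) (k : ℕ) :
    k * b ≤ cumLog Φ v k := by
  unfold cumLog
  calc (k : ℝ) * b = ∑ _i ∈ range k, b := by simp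
    _ ≤ ∑ i ∈ range k, Real.log (Φ.levelGain v i) := sum_le_sum fun i _ => hb i

variable (Φ)

/-- The `k`-level DESIGN OPTIMUM (log scale): the best cumulative log-gain over ALL seeds, `log Q_k⋆`. -/
def design (k : ℕ) : ℝ := ⨆ v : X, cumLog Φ v k

/-- The DESIGN RATE `log ρ⋆ := inf_{k ≥ 1} design k / k` — log of the design spectral radius of the level map. -/
def designRate : ℝ := sInf ((fun k : ℕ => design Φ k / k) '' Set.Ici 1)

variable {Φ}

/-- Under a log-gain ceiling the `k`-level cumulative log-gains of all seeds are bounded above. -/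
theorem bddAbove_cumLog {B : ℝ} (hB : LogCeiling Φ B) (k : ℕ) :
    BddAbove (Set.range fun v : X => cumLog Φ v k) :=
  ⟨k * B, by rintro _ ⟨v, rfl⟩; exact cumLog_le hB v k⟩

/-- Every seed's `k`-level cumulative log-gain is at most the `k`-level design optimum. -/
theorem cumLog_le_design {B : ℝ} (hB : LogCeiling Φ B) (v : X) (k : ℕ) :
    cumLog Φ v k ≤ design Φ k :=
  le_ciSup (bddAbove_cumLog hB k) v

/-- The `k`-level design optimum is at most `k·B`. -/
theorem design_le [Nonempty X] {B : ℝ} (hB : LogCeiling Φ B) (k : ℕ) : design Φ k ≤ k * B :=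
  ciSup_le fun v => cumLog_le hB v k

/-- The depth-0 design optimum is `0`. -/
@[simp] theorem design_zero [Nonempty X] : design Φ 0 = 0 := by simp [design]

/-- **Subadditivity of the design sequence** (the cocycle + "the second leg is itself a design"). -/
theorem design_subadditive [Nonempty X] {B : ℝ} (hB : LogCeiling Φ B) :
    Subadditive (design Φ) := by
  intro m n
  show (⨆ v : X, cumLog Φ v (m + n)) ≤ design Φ m + design Φ n
  refine ciSup_le fun v => ?_
  rw [cumLog_add]
  exact add_le_add (cumLog_le_design hB v m) (cumLog_le_design hB _ n)

/-- The design rate is Mathlib's `Subadditive.lim` of the design sequence. -/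
theorem designRate_eq_lim (h : Subadditive (design Φ)) : designRate Φ = h.lim := by
  rw [Subadditive.lim]
  rfl

/-- `log ρ⋆ ≤ design k / k` for every depth `k ≥ 1` (each finite-depth design optimum CAPS the rate). -/
theorem designRate_le_div (h : Subadditive (design Φ))
    (hbdd : BddBelow (Set.range fun k : ℕ => design Φ k / k)) {k : ℕ} (hk : k ≠ 0) :
    designRate Φ ≤ design Φ k / k := by
  rw [designRate_eq_lim h]
  exact h.lim_le_div hbdd hk

/-- **Fekete**: `design k / k → log ρ⋆`. -/
theorem tendsto_designRate (h : Subadditive (design Φ))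
    (hbdd : BddBelow (Set.range fun k : ℕ => design Φ k / k)) :
    Tendsto (fun k : ℕ => design Φ k / k) atTop (𝓝 (designRate Φ)) := by
  rw [designRate_eq_lim h]
  exact h.tendsto_lim hbdd

/-- Bounded-below-ness of `design k / k` from ONE seed whose log-gains are bounded below. -/
theorem bddBelow_design_div {B : ℝ} (hB : LogCeiling Φ B) {v : X} {b : ℝ}
    (hb : ∀ n, b ≤ Real.log (Φ.levelGain v n)) :
    BddBelow (Set.range fun k : ℕ => design Φ k / k) := by
  refine ⟨min b 0, ?_⟩
  rintro _ ⟨k, rfl⟩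
  rcases Nat.eq_zero_or_pos k with rfl | hk
  · simp
  · have hk' : (0 : ℝ) < k := Nat.cast_pos.mpr hk
    show min b 0 ≤ design Φ k / k
    rw [le_div_iff₀ hk']
    calc min b 0 * (k : ℝ) ≤ b * k := mul_le_mul_of_nonneg_right (min_le_left b 0) hk'.le
      _ = k * b := mul_comm _ _
      _ ≤ cumLog Φ v k := mul_le_cumLog hb k
      _ ≤ design Φ k := cumLog_le_design hB v k

/-! ## The one-window kill and its completeness -/

/-- **One-window kill.**  If some `k`-level design optimum is short of `k` floors (`design k < k·log λ`,
i.e. `Q_k⋆ < λᵏ`), then EVERY seed's ladder is below the floor somewhere in EVERY window of `k` levels. -/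
theorem exists_subfloor_in_window {B : ℝ} (hB : LogCeiling Φ B) {k : ℕ}
    (hkill : design Φ k < k * Real.log Φ.lam) (v : X) (n : ℕ) :
    ∃ i < k, Φ.levelRatio v (n + i) < 1 := by
  by_contra hcon
  have hfloor : ∀ i < k, 1 ≤ Φ.levelRatio v (n + i) := fun i hi =>
    not_lt.mp fun hlt => hcon ⟨i, hi, hlt⟩
  have h1 := window_le_cumLog hfloor
  have h2 := cumLog_le_design hB (Φ.M^[n] v) k
  linarith

/-- Hence every seed is below the floor infinitely often … -/
theorem frequently_subfloor {B : ℝ} (hB : LogCeiling Φ B) {k : ℕ}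
    (hkill : design Φ k < k * Real.log Φ.lam) (v : X) :
    ∃ᶠ n in atTop, Φ.levelRatio v n < 1 := by
  rw [frequently_atTop]
  intro N
  obtain ⟨i, -, hi⟩ := exists_subfloor_in_window hB hkill v N
  exact ⟨N + i, Nat.le_add_right N i, hi⟩

/-- … and NO seed of the manifold generates a machine, not even eventually. -/
theorem no_machine_of_design_lt {B : ℝ} (hB : LogCeiling Φ B) {k : ℕ}
    (hkill : design Φ k < k * Real.log Φ.lam) (v : X) :
    ¬ (∀ᶠ n in atTop, 1 ≤ Φ.levelRatio v n) := by
  rw [not_eventually]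
  exact (frequently_subfloor hB hkill v).mono fun n hn => not_le.mpr hn

/-- A machine seed forces `log λ ≤ design k / k` at every depth `k ≥ 1`. -/
theorem log_lam_le_div_of_machine {B : ℝ} (hB : LogCeiling Φ B) {v : X}
    (hmach : ∀ n, 1 ≤ Φ.levelRatio v n) {k : ℕ} (hk : k ≠ 0) :
    Real.log Φ.lam ≤ design Φ k / k := by
  have hk' : (0 : ℝ) < k := Nat.cast_pos.mpr (Nat.pos_of_ne_zero hk)
  rw [le_div_iff₀ hk', mul_comm]
  calc (k : ℝ) * Real.log Φ.lam ≤ cumLog Φ (Φ.M^[0] v) k :=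
        window_le_cumLog (n := 0) fun i _ => by simpa using hmach i
    _ ≤ design Φ k := cumLog_le_design hB _ k

/-- **Machine ⇒ `log λ ≤ log ρ⋆`.** -/
theorem log_lam_le_designRate_of_machine {B : ℝ} (hB : LogCeiling Φ B) {v : X}
    (hmach : ∀ n, 1 ≤ Φ.levelRatio v n) : Real.log Φ.lam ≤ designRate Φ := by
  unfold designRate
  refine le_csInf (Set.nonempty_Ici.image _) ?_
  rintro _ ⟨k, hk, rfl⟩
  have hk1 : 1 ≤ k := hk
  exact log_lam_le_div_of_machine hB hmach (by omega)

/-- An EVENTUAL machine (floor from some level on) is a machine seed further along the orbit. -/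
theorem log_lam_le_designRate_of_eventually {B : ℝ} (hB : LogCeiling Φ B) {v : X}
    (hmach : ∀ᶠ n in atTop, 1 ≤ Φ.levelRatio v n) : Real.log Φ.lam ≤ designRate Φ := by
  obtain ⟨N, hN⟩ := eventually_atTop.mp hmach
  refine log_lam_le_designRate_of_machine hB (v := Φ.M^[N] v) fun n => ?_
  have h := hN (N + n) (Nat.le_add_right N n)
  have e : Φ.levelRatio (Φ.M^[N] v) n = Φ.levelRatio v (N + n) := by
    show Φ.levelGain (Φ.M^[N] v) n / Φ.lam = Φ.levelGain v (N + n) / Φ.lam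
    rw [levelGain_shift]
  rw [e]
  exact h

/-- **Completeness of finite-depth designs.**  If the design rate is short of `log λ`, SOME finite depth
already certifies it: the kill is always visible at a finite level. -/
theorem exists_depth_of_designRate_lt (hlt : designRate Φ < Real.log Φ.lam) :
    ∃ k : ℕ, 1 ≤ k ∧ design Φ k < k * Real.log Φ.lam := by
  unfold designRate at hlt
  obtain ⟨_, ⟨k, hk, rfl⟩, hx⟩ := exists_lt_of_csInf_lt (Set.nonempty_Ici.image _) hlt
  have hk1 : 1 ≤ k := hk
  refine ⟨k, hk1, ?_⟩
  have hk' : (0 : ℝ) < k := Nat.cast_pos.mpr (by omega)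
  have hx' : design Φ k / k < Real.log Φ.lam := hx
  rwa [div_lt_iff₀ hk', mul_comm] at hx'

/-- `ρ⋆ < λ` iff some finite depth kills (needs the Fekete hypotheses for the easy direction). -/
theorem designRate_lt_iff (h : Subadditive (design Φ))
    (hbdd : BddBelow (Set.range fun k : ℕ => design Φ k / k)) :
    designRate Φ < Real.log Φ.lam ↔ ∃ k : ℕ, 1 ≤ k ∧ design Φ k < k * Real.log Φ.lam := by
  refine ⟨exists_depth_of_designRate_lt, fun ⟨k, hk, hlt⟩ => ?_⟩
  have hk' : (0 : ℝ) < k := Nat.cast_pos.mpr (by omega)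
  refine (designRate_le_div h hbdd (k := k) (by omega)).trans_lt ?_
  rwa [div_lt_iff₀ hk', mul_comm]

/-- The kill read through the rate: `ρ⋆ < λ` ⇒ no seed is even an eventual machine. -/
theorem no_machine_of_designRate_lt {B : ℝ} (hB : LogCeiling Φ B)
    (hlt : designRate Φ < Real.log Φ.lam) (v : X) : ¬ (∀ᶠ n in atTop, 1 ≤ Φ.levelRatio v n) :=
  fun hmach => absurd hlt (not_lt.mpr (log_lam_le_designRate_of_eventually hB hmach))

/-! ## The lower bracket from power iteration -/

/-- **Lower bracket.**  If along SOME seed's power iteration the gains converge to `g > 0`, then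
`log g ≤ log ρ⋆`: the attractor's per-level gain is a lower bracket of the design spectral radius. -/
theorem log_le_designRate_of_tendsto {B : ℝ} (hB : LogCeiling Φ B) (h : Subadditive (design Φ))
    (hbdd : BddBelow (Set.range fun k : ℕ => design Φ k / k)) {v : X} {g : ℝ} (hg : 0 < g)
    (hlim : Tendsto (fun n => Φ.levelGain v n) atTop (𝓝 g)) :
    Real.log g ≤ designRate Φ := by
  have hlog : Tendsto (fun n => Real.log (Φ.levelGain v n)) atTop (𝓝 (Real.log g)) :=
    hlim.log hg.ne'
  have hces : Tendsto (fun k : ℕ => (k⁻¹ : ℝ) * cumLog Φ v k) atTop (𝓝 (Real.log g)) := hlog.cesaro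
  refine le_of_tendsto_of_tendsto' hces (tendsto_designRate h hbdd) fun k => ?_
  rw [inv_mul_eq_div]
  gcongr
  exact cumLog_le_design hB v k

/-! ## Numerical pins (cell numbers of record; `λ = 2`) -/

/-- Depth 1 does NOT kill: the certified one-level optimum `g⋆ = 3.2067` exceeds `λ = 2`
(`design 1 = log 3.2067 ≥ 1·log 2`). -/
theorem depth_one_no_kill : ¬ (Real.log 3.2067 < 1 * Real.log 2) := by
  rw [one_mul, not_lt]
  exact Real.log_le_log (by norm_num) (by norm_num)

/-- Depth 2 KILLS on the measured slice: `Q₂⋆ ≤ 2.12 < 4 = λ²`, i.e. `log 2.12 < 2·log 2`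
(so `design 2 ≤ log 2.12` puts every seed of that slice below the floor in every pair of levels). -/
theorem depth_two_kill : Real.log 2.12 < 2 * Real.log 2 := by
  have h : Real.log ((2 : ℝ) ^ 2) = 2 * Real.log 2 := by
    rw [Real.log_pow]; norm_num
  rw [← h]
  exact Real.log_lt_log (by norm_num) (by norm_num)

/-- The bracket of record is consistent and sub-critical:
`log ḡ_∞ = log 0.58 < 0 < ½·log 2.12 < log 2 = log λ` (power-iteration floor below, depth-2 design cap above). -/
theorem bracket_pins :
    Real.log 0.58 < 0 ∧ 0 < Real.log 2.12 / 2 ∧ Real.log 2.12 / 2 < Real.log 2 := by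
  refine ⟨Real.log_neg (by norm_num) (by norm_num), ?_, ?_⟩
  · have : 0 < Real.log 2.12 := Real.log_pos (by norm_num)
    linarith
  · have := depth_two_kill
    linarith

end Summit.NavierStokesRegularity.FluidComputer.DesignSpectralRadius
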